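import Literature.NumberTheory.EllipticCurves.TransverseConditionGaloisTransport
import Literature.NumberTheory.EllipticCurves.HeegnerPointsOfConductor
import HarnessLib

/-!
# `σ_* = conjActPlace` preserves the transverse FAMILY `⨅_{ℓ ∣ c, ℓ ∈ v} ⨅_{w' ∣ v} ker(H¹(K_v, E[n]) → H¹(K[ℓ]_{w'}, E[n]))`
# of the ring class fields (Jetchev 2008 §3.1.2, §5; Gross 1991 §3)

Topic `NumberTheory/EllipticCurves`, namespace `Literature.NumberTheory.EllipticCurves`; a short sequel of
`TransverseConditionGaloisTransport.lean` (`conjActPlace_mem_iInf_transverseSubgroup_adicCompletion`: for ONE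
finite Galois `E/K` normal over `ℚ`, `σ_*` maps `⨅_{w' ∣ v} ker(H¹(K_v, E[n]) → H¹(E_{w'}, E[n]))` into the same
subgroup at `σ v`).  THEOREMS ONLY: no definition, no named fact, no instance (D-0026).  This file passes to
the shape in which the transverse Selmer structure of Jetchev's argument is written in the tree
(`Summit…JET.exists_localTransverseFamily`, binders `h𝒯σ`/`h𝒯sd` of `JET.tamagawaExponent_le_mInfty_of_localFacts'`):
a finite family of such fields indexed by the primes `ℓ ∣ c`, with the side condition `ℓ ∈ v`.

* `conjActPlace_mem_iInf_transverseSubgroup_family` — for number fields `F ℓ` (`ℓ ∈ S`) Galois over `K` and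
  normal over `ℚ`: `σ_*` maps `⨅_{ℓ ∈ S, ℓ ∈ v} ⨅_{w' ∣ v} ker(H¹(K_v, E[n]) → H¹((F ℓ)_{w'}, E[n]))` into
  `⨅_{ℓ ∈ S, ℓ ∈ σv} ⨅_{w'' ∣ σv} ker(H¹(K_{σv}, E[n]) → H¹((F ℓ)_{w''}, E[n]))` (`ℓ ∈ σ v ↔ ℓ ∈ v`: `σ` fixes `ℓ`).
* **`conjActPlace_mem_iInf_transverseSubgroup_ringClassField`** — the same for the ring class fields
  `K[ℓ] = ringClassField K ι ℓ ⊂ ℂ`, `ℓ ∣ c`, of an imaginary quadratic `K` (`K[ℓ]/K` Galois: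
  `finiteDimensional_and_isGalois_ringClassField`; `K[ℓ]/ℚ` NORMAL — Cox Lemma 9.3, Gross §3 «`K_n` is Galois
  over `ℚ`» — is the hypothesis `hnormal`, available Summits-side as `X11b.RingClassConj.isGalois_rat_ringClassField`).
  After `rw` with the defining `⨅`-equation of the family this IS the binder `h𝒯σ` («the intrinsic transverse
  condition is `τ`-stable, Gross §3 dihedral»); the hypothesis `v ∈ placesDividing K c` of the binder is not needed.

HONEST FRAMING (cell `bsd-jet`, programme file §HONESTY, verbatim): «no tranche here proves BSD; ARM L moves the
LITERAL column of an r ≤ 1 census into the kernel-proved-modulo-named-print column.»  Plumbing only; 0 classes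
move; nothing `p`-specific; nothing about Heegner points or Kolyvagin classes is asserted.

## References

* D. Jetchev, *Global divisibility of Heegner points and Tamagawa numbers*, Compos. Math. 144 (2008),
  §3.1.2 (p. 814: `H¹_tr(K_λ, E[p^k])`), §5 Thm. 5.2 and proof (pp. 821–823). [Jetchev2008]
* B. H. Gross, *Kolyvagin's work on modular elliptic curves*, LMS LNS 153 (1991), §3 («`K_n` is Galois over
  `ℚ` … `τστ⁻¹ = σ⁻¹`»). [GrossLMS1991]
* D. A. Cox, *Primes of the form x² + ny²*, 2nd ed. (2013), §9.A Lemma 9.3. [Cox2013]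
* J. W. S. Cassels, A. Fröhlich (eds.), *Algebraic Number Theory* (1967), Ch. VII (Tate) §1.1
  (conjugate places over the same rational prime). [CasselsFrohlichANT1967]

## Tree search

`lean search 'conjActPlace_mem'`: `conjActPlace_mem_kummerSelmerStructure` (`SelmerGaloisActionPlaces`),
`conjActPlace_mem_transverseSubgroup_adicCompletion`, `conjActPlace_mem_iInf_transverseSubgroup_adicCompletion`
(`TransverseConditionGaloisTransport`, reused here); the family / ring-class form is not in the tree
(Summits-side `JET.exists_localTransverseFamily` only DEFINES the family).
-/

noncomputable section

open scoped Classical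
open WeierstrassCurve Field
open Literature.NumberTheory.GaloisRepresentations

universe u

namespace Literature.NumberTheory.EllipticCurves

section Family

open NumberField IsDedekindDomain Literature.NumberTheory.Automorphic

variable {K : Type u} [Field K] [NumberField K] (W : WeierstrassCurve ℚ) (σ : K ≃ₐ[ℚ] K) (n : ℤ)

/-- A rational integer lies in `σ • v` iff it lies in `v` (`σ` fixes `ℓ`; conjugate places lie over the same
rational prime). [cite: CasselsFrohlichANT1967, Ch. VII §1.1] -/
private theorem natCast_mem_smul_asIdeal_iff (v : HeightOneSpectrum (𝓞 K)) (ℓ : ℕ) :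
    ((ℓ : ℕ) : 𝓞 K) ∈ (σ • v).asIdeal ↔ ((ℓ : ℕ) : 𝓞 K) ∈ v.asIdeal := by
  have hfix : σ • ((ℓ : ℕ) : 𝓞 K) = (ℓ : 𝓞 K) := map_natCast (MulSemiringAction.toRingHom _ (𝓞 K) σ) ℓ
  rw [← HeightOneSpectrum.smul_mem_smul_asIdeal_iff σ v ((ℓ : ℕ) : 𝓞 K), hfix]

/-- **Family version of the transport of transverse conditions** (the shape of a transverse Selmer
structure): for number fields `F ℓ`, `ℓ ∈ S`, Galois over `K` and normal over `ℚ`, and `σ • v = w`, `σ_*` maps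
`⨅_{ℓ ∈ S, ℓ ∈ v} ⨅_{w' ∣ v} ker(H¹(K_v, E[n]) → H¹((F ℓ)_{w'}, E[n]))` into
`⨅_{ℓ ∈ S, ℓ ∈ w} ⨅_{w'' ∣ w} ker(H¹(K_w, E[n]) → H¹((F ℓ)_{w''}, E[n]))` — factor by factor by
`conjActPlace_mem_iInf_transverseSubgroup_adicCompletion`, using `ℓ ∈ σ • v ↔ ℓ ∈ v`.
[cite: Jetchev2008, §3.1.2 (p. 814), §5 (proof of Thm. 5.2)] [cite: GrossLMS1991, §3] -/
theorem conjActPlace_mem_iInf_transverseSubgroup_family (F : ℕ → Type u) [∀ ℓ, Field (F ℓ)]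
    [∀ ℓ, NumberField (F ℓ)] [∀ ℓ, Algebra K (F ℓ)] (S : Finset ℕ)
    (hgal : ∀ ℓ ∈ S, IsGalois K (F ℓ)) (hnormal : ∀ ℓ ∈ S, Normal ℚ (F ℓ))
    {v w : HeightOneSpectrum (𝓞 K)} (h : σ • v = w)
    {x : galoisCohomology (((W.baseChange K).torsionGaloisModule n).toLocal (Sum.inr v : Place K)) 1}
    (hx : x ∈ ⨅ ℓ ∈ S.filter (fun ℓ : ℕ ↦ ((ℓ : ℕ) : 𝓞 K) ∈ v.asIdeal),
      ⨅ (w' : HeightOneSpectrum (𝓞 (F ℓ))) (_ : w'.asIdeal.LiesOver v.asIdeal),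
        letI := (adicCompletionOfLiesOver K (F ℓ) v w').toAlgebra
        DiscreteGaloisModule.transverseSubgroup
          (GaloisRep.toLocal v ((W.baseChange K).torsionGaloisModule n)) (w'.adicCompletion (F ℓ))) :
    conjActPlace W σ n h x ∈ ⨅ ℓ ∈ S.filter (fun ℓ : ℕ ↦ ((ℓ : ℕ) : 𝓞 K) ∈ w.asIdeal),
      ⨅ (w'' : HeightOneSpectrum (𝓞 (F ℓ))) (_ : w''.asIdeal.LiesOver w.asIdeal),
        letI := (adicCompletionOfLiesOver K (F ℓ) w w'').toAlgebra
        DiscreteGaloisModule.transverseSubgroup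
          (GaloisRep.toLocal w ((W.baseChange K).torsionGaloisModule n)) (w''.adicCompletion (F ℓ)) := by
  refine AddSubgroup.mem_iInf.mpr fun ℓ => AddSubgroup.mem_iInf.mpr fun hℓ => ?_
  rw [Finset.mem_filter] at hℓ
  have hℓv : ((ℓ : ℕ) : 𝓞 K) ∈ v.asIdeal := by
    rw [← natCast_mem_smul_asIdeal_iff σ v ℓ, h]; exact hℓ.2
  have hx₁ := (AddSubgroup.mem_iInf.mp ((AddSubgroup.mem_iInf.mp hx) ℓ))
    (Finset.mem_filter.mpr ⟨hℓ.1, hℓv⟩)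
  haveI := hgal ℓ hℓ.1
  haveI := hnormal ℓ hℓ.1
  exact conjActPlace_mem_iInf_transverseSubgroup_adicCompletion W σ n (F ℓ) h hx₁

/-- **`τ`-stability of the ring-class transverse family** — the input «`H¹_tr(K_λ)` is `τ`-stable (Gross §3
dihedral)» of Jetchev's Thm. 5.2 line in the tree (`JET.tamagawaExponent_le_mInfty_of_localFacts'`, binder
`h𝒯σ`, after rewriting with the family's defining `⨅`-equation): for `K` imaginary quadratic, `σ ∈ Aut(K/ℚ)`,
`σ • v = w`, and the ring class fields `K[ℓ] = ringClassField K ι ℓ`, `ℓ ∣ c` (Galois over `K` by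
`finiteDimensional_and_isGalois_ringClassField`; NORMAL OVER `ℚ` — Cox Lemma 9.3 — the hypothesis `hnormal`,
Summits-side `X11b.RingClassConj.isGalois_rat_ringClassField`), `σ_*` maps
`⨅_{ℓ ∣ c, ℓ ∈ v} ⨅_{w' ∣ v} ker(H¹(K_v, E[n]) → H¹(K[ℓ]_{w'}, E[n]))` into the same subgroup at `w`.
[cite: Jetchev2008, §3.1.2 (p. 814), §5 Thm. 5.2 (p. 821)] [cite: GrossLMS1991, §3] [cite: Cox2013, §9.A Lemma 9.3] -/
theorem conjActPlace_mem_iInf_transverseSubgroup_ringClassField {K : Type} [Field K] [NumberField K]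
    (W : WeierstrassCurve ℚ) (σ : K ≃ₐ[ℚ] K) (n : ℤ) (hK : IsImaginaryQuadratic K) (ι : K →+* ℂ)
    [∀ j : ℕ, NumberField (ringClassField K ι j)] (c : ℕ)
    (hnormal : ∀ ℓ ∈ c.primeFactors, Normal ℚ (ringClassField K ι ℓ))
    {v w : HeightOneSpectrum (𝓞 K)} (h : σ • v = w)
    {x : galoisCohomology (((W.baseChange K).torsionGaloisModule n).toLocal (Sum.inr v : Place K)) 1}
    (hx : x ∈ ⨅ ℓ ∈ c.primeFactors.filter (fun ℓ : ℕ ↦ ((ℓ : ℕ) : 𝓞 K) ∈ v.asIdeal),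
      ⨅ (w' : HeightOneSpectrum (𝓞 (ringClassField K ι ℓ))) (_ : w'.asIdeal.LiesOver v.asIdeal),
        letI := (adicCompletionOfLiesOver K (ringClassField K ι ℓ) v w').toAlgebra
        DiscreteGaloisModule.transverseSubgroup
          (GaloisRep.toLocal v ((W.baseChange K).torsionGaloisModule n))
          (w'.adicCompletion (ringClassField K ι ℓ))) :
    conjActPlace W σ n h x ∈ ⨅ ℓ ∈ c.primeFactors.filter (fun ℓ : ℕ ↦ ((ℓ : ℕ) : 𝓞 K) ∈ w.asIdeal),
      ⨅ (w'' : HeightOneSpectrum (𝓞 (ringClassField K ι ℓ))) (_ : w''.asIdeal.LiesOver w.asIdeal),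
        letI := (adicCompletionOfLiesOver K (ringClassField K ι ℓ) w w'').toAlgebra
        DiscreteGaloisModule.transverseSubgroup
          (GaloisRep.toLocal w ((W.baseChange K).torsionGaloisModule n))
          (w''.adicCompletion (ringClassField K ι ℓ)) :=
  conjActPlace_mem_iInf_transverseSubgroup_family W σ n (fun ℓ => ringClassField K ι ℓ) c.primeFactors
    (fun _ hℓ => (finiteDimensional_and_isGalois_ringClassField hK ι
      (Nat.prime_of_mem_primeFactors hℓ).ne_zero).2) hnormal h hx

end Family

end Literature.NumberTheory.EllipticCurves

end
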